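import Summits.AtomisticToContinuum.HydrodynamicLimit.Theses.TwoClocks

/-!
# Newton-cradle pulse, part 1: the first contact time of a flight (helper file, refutation of `EquilibriumClampedCollisionalWindowLD`, stmt-AtomisticToContinuum-13733, layer L3; see `Cruxes/EquilibriumClampedCollisionalWindowLD/Disproof.lean`, evidence WITNESS.md §4.3; no Theses declaration is asserted; refuter-cdisprove-stmt-AtomisticToContinuum-13733-0)

`parC`/`perpC` decomposition along the relative velocity, `hitTime` (smaller root of `‖a - θ U‖ = ε`), `hitTime_spec`, `hitNormal_spec`.
-/

noncomputable section

open Real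
open scoped InnerProductSpace

namespace Summit.AtomisticToContinuum.HydrodynamicLimit.Theorems

namespace EquilibriumClampedCollisionalWindowLDNegative

section HitTime

variable {E : Type*} [NormedAddCommGroup E] [InnerProductSpace ℝ E]

/-- Signed length of `a` along `U`: `⟪a, U⟫ / ‖U‖`. [folklore] -/
def parC (a U : E) : ℝ := ⟪a, U⟫_ℝ / ‖U‖

/-- Component of `a` orthogonal to `U`. [folklore] -/
def perpC (a U : E) : E := a - (⟪a, U⟫_ℝ / ‖U‖ ^ 2) • U

/-- The first contact time: the smaller root `θ` of `‖a - θ U‖ = ε` (meaningful when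
`‖perpC a U‖ < ε < parC a U`). [folklore] -/
def hitTime (a U : E) (ε : ℝ) : ℝ := (parC a U - Real.sqrt (ε ^ 2 - ‖perpC a U‖ ^ 2)) / ‖U‖

variable {a U : E} {ε : ℝ}

/-- The orthogonal component is orthogonal to `U`. [folklore] -/
theorem inner_perpC_right (a U : E) : ⟪perpC a U, U⟫_ℝ = 0 := by
  unfold perpC
  rw [inner_sub_left, real_inner_smul_left, real_inner_self_eq_norm_sq]
  by_cases hU : ‖U‖ = 0
  · have : U = 0 := norm_eq_zero.1 hU
    simp [this]
  · field_simp
    ring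

/-- Decomposition of `a` along and across `U`. [folklore] -/
theorem perpC_add_smul (hU : U ≠ 0) (a : E) : perpC a U + (parC a U / ‖U‖) • U = a := by
  unfold perpC parC
  have hn : ‖U‖ ≠ 0 := norm_ne_zero_iff.2 hU
  rw [div_div, ← pow_two, sub_add_cancel]

/-- Pythagoras along/across `U`: `‖a - θ U‖² = (parC a U - θ ‖U‖)² + ‖perpC a U‖²`. [folklore] -/
theorem norm_sub_smul_sq (hU : U ≠ 0) (a : E) (θ : ℝ) :
    ‖a - θ • U‖ ^ 2 = (parC a U - θ * ‖U‖) ^ 2 + ‖perpC a U‖ ^ 2 := by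
  have hn : ‖U‖ ≠ 0 := norm_ne_zero_iff.2 hU
  have hdecomp : a - θ • U = perpC a U + (parC a U / ‖U‖ - θ) • U := by
    conv_lhs => rw [← perpC_add_smul hU a]
    rw [sub_smul, add_sub_assoc]
  rw [hdecomp, norm_add_sq_real, real_inner_smul_right, inner_perpC_right, mul_zero, mul_zero,
    add_zero, norm_smul, Real.norm_eq_abs, mul_pow, sq_abs]
  field_simp
  ring

/-- `‖a‖² = parC² + ‖perpC‖²`. [folklore] -/
theorem norm_sq_eq_parC_sq_add (hU : U ≠ 0) (a : E) :
    ‖a‖ ^ 2 = parC a U ^ 2 + ‖perpC a U‖ ^ 2 := by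
  have := norm_sub_smul_sq hU a 0
  simpa using this

/-- The component along `U` is at most the norm. [folklore] -/
theorem parC_le_norm (hU : U ≠ 0) (a : E) : parC a U ≤ ‖a‖ := by
  have h := norm_sq_eq_parC_sq_add hU a
  nlinarith [norm_nonneg a, norm_nonneg (perpC a U), sq_nonneg (parC a U + ‖a‖)]

/-- The orthogonal component is at most the norm. [folklore] -/
theorem norm_perpC_le_norm (hU : U ≠ 0) (a : E) : ‖perpC a U‖ ≤ ‖a‖ := by
  have h := norm_sq_eq_parC_sq_add hU a
  nlinarith [norm_nonneg a, norm_nonneg (perpC a U), sq_nonneg (parC a U)]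

/-- `‖a‖ - parC ≤ ‖perpC‖² / ‖a‖` when `parC ≥ 0` (second-order smallness of the defect). [folklore] -/
theorem norm_sub_parC_le (hU : U ≠ 0) (ha : a ≠ 0) (hpar : 0 ≤ parC a U) :
    ‖a‖ - parC a U ≤ ‖perpC a U‖ ^ 2 / ‖a‖ := by
  have h := norm_sq_eq_parC_sq_add hU a
  have hna : 0 < ‖a‖ := norm_pos_iff.2 ha
  rw [le_div_iff₀ hna]
  nlinarith [parC_le_norm hU a]

/-- The orthogonal component is the distance to the line: `‖perpC a U‖ ≤ ‖a - c U‖`. [folklore] -/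
theorem norm_perpC_le (hU : U ≠ 0) (a : E) (c : ℝ) : ‖perpC a U‖ ≤ ‖a - c • U‖ := by
  have h := norm_sub_smul_sq hU a c
  have h1 : ‖perpC a U‖ ^ 2 ≤ ‖a - c • U‖ ^ 2 := by
    rw [h]; nlinarith [sq_nonneg (parC a U - c * ‖U‖)]
  exact le_of_not_gt fun hlt => by
    nlinarith [norm_nonneg (a - c • U), norm_nonneg (perpC a U),
      mul_self_lt_mul_self (norm_nonneg _) hlt]

/-- `ε - p²/ε ≤ √(ε² - p²)` for `0 ≤ p < ε` (since `(ε - p²/ε)² = ε² - 2p² + p⁴/ε² ≤ ε² - p²`). [folklore] -/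
theorem sub_sq_div_le_sqrt {ε p : ℝ} (hε : 0 < ε) (hp0 : 0 ≤ p) (hp : p < ε) :
    ε - p ^ 2 / ε ≤ Real.sqrt (ε ^ 2 - p ^ 2) := by
  by_cases hs : ε - p ^ 2 / ε ≤ 0
  · exact hs.trans (Real.sqrt_nonneg _)
  push Not at hs
  have hpε : p ^ 2 ≤ ε ^ 2 := by nlinarith
  have h4 : p ^ 4 / ε ^ 2 ≤ p ^ 2 := by
    rw [div_le_iff₀ (by positivity)]
    nlinarith [sq_nonneg p]
  have hsq : (ε - p ^ 2 / ε) ^ 2 ≤ ε ^ 2 - p ^ 2 := by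
    have : (ε - p ^ 2 / ε) ^ 2 = ε ^ 2 - 2 * p ^ 2 + p ^ 4 / ε ^ 2 := by
      field_simp; ring
    rw [this]; linarith
  calc ε - p ^ 2 / ε = Real.sqrt ((ε - p ^ 2 / ε) ^ 2) := (Real.sqrt_sq hs.le).symm
    _ ≤ Real.sqrt (ε ^ 2 - p ^ 2) := Real.sqrt_le_sqrt hsq

/-- Hypotheses for a clean first contact: the line of flight passes at distance `< ε` and the
target is ahead (`parC > ε`). Then the hit time is positive, is a contact, nothing is hit before,
and it is pinched between `(parC - ε)/‖U‖` and `(parC - ε + ‖perpC‖²/ε)/‖U‖`. -/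
theorem hitTime_spec (hU : U ≠ 0) (hε : 0 < ε) (hperp : ‖perpC a U‖ < ε) (hpar : ε < parC a U) :
    0 < hitTime a U ε ∧ ‖a - hitTime a U ε • U‖ = ε ∧
      (∀ θ, 0 ≤ θ → θ < hitTime a U ε → ε < ‖a - θ • U‖) ∧
      (parC a U - ε) / ‖U‖ ≤ hitTime a U ε ∧
      hitTime a U ε ≤ (parC a U - ε + ‖perpC a U‖ ^ 2 / ε) / ‖U‖ := by
  have hn : 0 < ‖U‖ := norm_pos_iff.2 hU
  set p := ‖perpC a U‖ with hp
  have hp0 : 0 ≤ p := norm_nonneg _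
  have hrad : 0 < ε ^ 2 - p ^ 2 := by nlinarith
  set q := Real.sqrt (ε ^ 2 - p ^ 2) with hq
  have hq0 : 0 ≤ q := Real.sqrt_nonneg _
  have hqsq : q ^ 2 = ε ^ 2 - p ^ 2 := Real.sq_sqrt hrad.le
  have hqε : q ≤ ε := by nlinarith [hqsq, sq_nonneg p]
  have hqlow : ε - p ^ 2 / ε ≤ q := sub_sq_div_le_sqrt hε hp0 hperp
  have hθ : hitTime a U ε = (parC a U - q) / ‖U‖ := rfl
  have hmul : hitTime a U ε * ‖U‖ = parC a U - q := by rw [hθ, div_mul_cancel₀ _ hn.ne']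
  refine ⟨?_, ?_, ?_, ?_, ?_⟩
  · rw [hθ]; exact div_pos (by linarith) hn
  · have h := norm_sub_smul_sq hU a (hitTime a U ε)
    rw [hmul] at h
    have h' : ‖a - hitTime a U ε • U‖ ^ 2 = ε ^ 2 := by
      rw [h]; nlinarith
    nlinarith [norm_nonneg (a - hitTime a U ε • U), sq_nonneg (‖a - hitTime a U ε • U‖ - ε),
      sq_nonneg (‖a - hitTime a U ε • U‖ + ε)]
  · intro θ hθ0 hθlt
    have h := norm_sub_smul_sq hU a θ
    have h1 : q < parC a U - θ * ‖U‖ := by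
      rw [hθ, lt_div_iff₀ hn] at hθlt
      linarith
    have h2 : ε ^ 2 < ‖a - θ • U‖ ^ 2 := by
      rw [h]; nlinarith
    nlinarith [norm_nonneg (a - θ • U)]
  · rw [hθ]
    exact div_le_div_of_nonneg_right (by linarith) hn.le
  · rw [hθ]
    exact div_le_div_of_nonneg_right (by linarith) hn.le

/-- The contact normal `n = (a - θ⋆ U)/ε` at the hit time: it is a unit vector, the normal relative
speed is `⟪U, n⟫ = ‖U‖ √(ε² - ‖perpC‖²)/ε ≥ ‖U‖ (1 - ‖perpC‖²/ε²) > 0`, and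
`a - θ⋆ U = (√(ε² - ‖perpC‖²)/‖U‖) U + perpC`. [folklore] -/
theorem hitNormal_spec (hU : U ≠ 0) (hε : 0 < ε) (hperp : ‖perpC a U‖ < ε) :
    a - hitTime a U ε • U =
        (Real.sqrt (ε ^ 2 - ‖perpC a U‖ ^ 2) / ‖U‖) • U + perpC a U ∧
      ⟪U, a - hitTime a U ε • U⟫_ℝ = ‖U‖ * Real.sqrt (ε ^ 2 - ‖perpC a U‖ ^ 2) ∧
      ‖U‖ * (ε - ‖perpC a U‖ ^ 2 / ε) ≤ ⟪U, a - hitTime a U ε • U⟫_ℝ := by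
  have hn : 0 < ‖U‖ := norm_pos_iff.2 hU
  set p := ‖perpC a U‖ with hp
  have hp0 : 0 ≤ p := norm_nonneg _
  have hrad : 0 < ε ^ 2 - p ^ 2 := by nlinarith
  set q := Real.sqrt (ε ^ 2 - p ^ 2) with hq
  have hq0 : 0 ≤ q := Real.sqrt_nonneg _
  have hdec : a - hitTime a U ε • U = (q / ‖U‖) • U + perpC a U := by
    have h1 := perpC_add_smul hU a
    unfold hitTime
    rw [← hp, ← hq]
    calc a - ((parC a U - q) / ‖U‖) • U
        = (perpC a U + (parC a U / ‖U‖) • U) - ((parC a U - q) / ‖U‖) • U := by rw [h1]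
      _ = (q / ‖U‖) • U + perpC a U := by
          rw [sub_div, sub_smul]; abel
  have hinner : ⟪U, a - hitTime a U ε • U⟫_ℝ = ‖U‖ * q := by
    rw [hdec, inner_add_right, real_inner_smul_right, real_inner_self_eq_norm_sq, real_inner_comm,
      inner_perpC_right, add_zero, div_mul_eq_mul_div, div_eq_iff hn.ne']
    ring
  refine ⟨hdec, hinner, ?_⟩
  rw [hinner]
  exact mul_le_mul_of_nonneg_left (sub_sq_div_le_sqrt hε hp0 hperp) hn.le

end HitTime

end EquilibriumClampedCollisionalWindowLDNegative

end Summit.AtomisticToContinuum.HydrodynamicLimit.Theorems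

end
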